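import Summits.Ventures.YMGap.RobustBall.BoxSumCLT
import Summits.Ventures.YMGap.RobustBall.BoxSumCLTCylinder
import Summits.Ventures.YMGap.RobustBall.UniformWilsonPointTwoSided
import Summits.Ventures.YMGap.RobustBall.UniformLoopCorrelatorDecay
import Summits.Ventures.YMGap.RobustBall.SpecificHeatFluctuation
import Literature.MathematicalPhysics.QuantumFieldTheory.Sweep1ShenZhuZhuProofs
import HarnessLib

/-!
# Venture YMGap, track ROBUST-BALL — THE CELL OF «C-CLT»: GAUSSIAN FLUCTUATIONS OF BLOCK OBSERVABLES OF `SU(2)` LATTICE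
# YANG–MILLS ON `ℤ⁴` AT STRONG COUPLING `|β_W| ≤ 1/12`

HONEST FRAMING. WHAT THIS IS: a venture file (cell `pub-ymgap`, track Y2 ROBUST-BALL, seat ds-3, theorems only): the `SU(2)` cell of
the object «C-CLT». Door cell IMPORTED (not re-proved): rb-p1's `su2_wilson_clustering_abs_le_oneTwelfth` (`UniformWilsonPointTwoSided.lean`:
for `|β_W| ≤ 1/12` every DLR state of `SU(2)` lattice Yang–Mills on `ℤ⁴`, tree coupling `β_W/2`, clusters on Lipschitz cylinders at rate
`log 2` with constant `32 n²` — `PerturbedClustering 4 2 (β_W/4) 0 _ (log 2) 32`) and ds-3's `su2_wilson_oneState_translationInvariant`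
(one translation-invariant DLR state on the vertex-star window). With the adapter `BoxSumCLTCylinder.pairClustering_of_perturbedClustering`
and the generic `BoxSumCLT.tendstoInDistribution_boxSum`:
★★★ `su2_wilson_boxSum_clt` — for EVERY `|β_W| ≤ 1/12` and EVERY Lipschitz cylinder observable `F` (support `Δ`, constant `K`; no gauge
invariance needed): the autocovariance `v ↦ cov_μ(F, F∘θ_v)` of the unique DLR state `μ` is absolutely summable and
`(Σ_{x∈B_n} F∘θ_x − #B_n·μ(F)) / √#B_n ⟶ N(0, χ(F))` IN DISTRIBUTION (Mathlib `TendstoInDistribution`, limit law `gaussianReal 0 χ(F)`),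
`χ(F) = Σ_{v∈ℤ⁴} cov_μ(F, F∘θ_v) ≥ 0` the static susceptibility of `ThermodynamicVariance.lean` (T73c), degenerate case `χ(F) = 0` included.
★★★ `suN_wilson_boxSum_clt` — EVERY `N ≥ 2` at 't Hooft `0 < β < 1/64` (rb-p1's hypothesis-free Bakry–Émery door
`suN_wilson_clustering_rate`), ★★ `su2_wilson_plaquette_clt` / `su2_wilson_loop_clt` (plaquette field, Wilson loops).
Sentence: «at strong coupling the block sums of any local observable fluctuate on the √volume scale with a Gaussian law whose variance is
the static susceptibility». WHAT THIS IS NOT: lattice strong coupling; a CLT for bounded local observables of the unique DLR state at the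
`√volume` scale; NOT `χ(F) > 0`, NOT a large-deviation principle, NOT a spectral / glueball / continuum statement, nothing about Clay. The
window upgrade to `0 ≤ β_W ≤ 1/3` is one theorem away (`StarDoorZdGeometricCells.su2_wilson_clustering_upTo_oneThird_explicit`) once
that file's olean exists.
References: E. Bolthausen, Ann. Probab. 10 (1982); H. Künsch, CMP 84 (1982) 207–222; the tree files named above.
-/

noncomputable section

open MeasureTheory Filter Topology ProbabilityTheory Real
open scoped NNReal
open Literature.Probability.LatticeModels hiding configShift configShift_apply
open Literature.MathematicalPhysics.QuantumLattice
open Literature.MathematicalPhysics.QuantumFieldTheory hiding ZdEdge Site IsLocalObservable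
open Summit.Ventures.YMGap.ZdSmoothing Summit.Ventures.YMGap.CouplingResponse

namespace Summit.Ventures.YMGap.RobustBall

namespace BoxSumCLT

/-- **A finite sum of Lipschitz cylinders is a Lipschitz cylinder** on the union of the supports with the sum of the constants.
[folklore] -/
theorem isLipschitzCylinder_sum {d N : ℕ} {ι : Type*} (s : Finset ι) {F : ι → LGConfig d (SUN N) → ℝ}
    {Λ : ι → Finset (ZdEdge d)} {K : ι → ℝ≥0} (hF : ∀ i ∈ s, IsLipschitzCylinder (fundamentalRep (Fin N)) (F i) (Λ i) (K i)) :
    IsLipschitzCylinder (fundamentalRep (Fin N)) (fun U => ∑ i ∈ s, F i U) (s.biUnion Λ) (∑ i ∈ s, K i) := by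
  classical
  refine isLipschitzCylinder_of_dist_le fun U V => ?_
  set δ := dist (fun e : ↥(s.biUnion Λ) => suEntries (U e)) (fun e : ↥(s.biUnion Λ) => suEntries (V e)) with hδ
  have hterm : ∀ i ∈ s, |F i U - F i V| ≤ K i * δ := fun i hi => by
    obtain ⟨g, hg, hFg⟩ := (hF i hi).exists_suEntries
    rw [hFg U, hFg V, ← Real.dist_eq]
    exact (hg.dist_le_mul _ _).trans (mul_le_mul_of_nonneg_left (dist_restrict_le (Finset.subset_biUnion_of_mem Λ hi) U V) (K i).2)
  calc |∑ i ∈ s, F i U - ∑ i ∈ s, F i V| = |∑ i ∈ s, (F i U - F i V)| := by rw [Finset.sum_sub_distrib]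
    _ ≤ ∑ i ∈ s, K i * δ := (Finset.abs_sum_le_sum_abs _ _).trans (Finset.sum_le_sum hterm)
    _ = ((∑ i ∈ s, K i : ℝ≥0) : ℝ) * δ := by rw [← Finset.sum_mul]; push_cast; rfl

/-- ★★★ **CELL — THE CENTRAL LIMIT THEOREM FOR `SU(2)` LATTICE YANG–MILLS ON `ℤ⁴` AT `|β_W| ≤ 1/12`.** For every `|β_W| ≤ 1/12`
(tree coupling `β_W/2`) there is exactly one DLR state `μ` (a probability measure); it is translation invariant; and for EVERY Lipschitz
cylinder observable `F`:
`Σ_v |cov_μ(F, F∘θ_v)| < ∞` and, for every random variable `Z` with law `N(0, Σ_v cov_μ(F, F∘θ_v))`,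
`(Σ_{x∈B_n} F∘θ_x − #B_n μ(F)) / √#B_n → Z` in distribution (`B_n = siteBox 4 n`, side `2n+1`). [folklore] -/
theorem su2_wilson_boxSum_clt {βW : ℝ} (hβ : |βW| ≤ 1 / 12)
    {Ω' : Type*} [MeasurableSpace Ω'] {P' : Measure Ω'} [IsProbabilityMeasure P'] (Z : Ω' → ℝ)
    {F : LGConfig 4 (SUN 2) → ℝ} {Δ : Finset (ZdEdge 4)} {K : ℝ≥0} (hF : IsLipschitzCylinder (fundamentalRep (Fin 2)) F Δ K) :
    ∃ μ : Measure (LGConfig 4 (SUN 2)), ∃ _ : IsProbabilityMeasure μ,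
      ymGibbsMeasures (d := 4) (fundamentalRep (Fin 2)) (βW / 2) = {μ} ∧ IsZdTranslationInvariant μ ∧
      Summable (fun v : Site 4 => |cov[F, fun U => F (configShift v U); μ]|) ∧
      (HasLaw Z (gaussianReal 0 (∑' v, cov[F, fun U => F (configShift v U); μ]).toNNReal) P' →
        TendstoInDistribution
          (fun n U => (∑ x ∈ siteBox 4 n, F (configShift x U) - (siteBox 4 n).card * ∫ V, F V ∂μ) / Real.sqrt ((siteBox 4 n).card))
          atTop Z (fun _ => μ) P') := by
  classical
  have hb : |βW / 2| ≤ 9 / 50 := by rw [abs_div, abs_two]; linarith [abs_nonneg βW]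
  obtain ⟨μ, hG, hinv⟩ := su2_wilson_oneState_translationInvariant hb
  have hμ : μ ∈ ymGibbsMeasures (d := 4) (fundamentalRep (Fin 2)) (βW / 2) := by rw [hG]; exact Set.mem_singleton μ
  have hμG : IsGibbsMeasure (ymSpecification (d := 4) (fundamentalRep (Fin 2)) (βW / 2)) μ := hμ
  haveI := hμG.isProbabilityMeasure
  -- the door cell: `PerturbedClustering 4 2 (β_W/4) 0 _ (log 2) 32`, and `μ` is a DLR state of the zero member
  have hcl := su2_wilson_clustering_abs_le_oneTwelfth hβ
  have hμ' : μ ∈ perturbedGibbsMeasures (d := 4) (fundamentalRep (Fin 2)) (2 * (βW / 4)) 0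
      (fun _ => (∅ : Finset (Finset (ZdEdge 4)))) := by
    rw [perturbedGibbsMeasures_zero, show (2 : ℝ) * (βW / 4) = βW / 2 by ring]; exact hμ
  -- the observable: measurable, bounded, base-point spread of its support
  have hFm : Measurable F := hF.measurable
  have hFb : ∀ U, |F U| ≤ |F 1| + 2 * K := hF.abs_le
  set δ : ℝ := ∑ e ∈ Δ, ∑ e' ∈ Δ, ‖e.1 - e'.1‖ with hδdef
  have hδ : ∀ e ∈ Δ, ∀ e' ∈ Δ, ‖e.1 - e'.1‖ ≤ δ := fun e he e' he' =>
    (Finset.single_le_sum (f := fun e'' : ZdEdge 4 => ‖e.1 - e''.1‖) (fun _ _ => norm_nonneg _) he').trans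
      (Finset.single_le_sum (f := fun e₀ : ZdEdge 4 => ∑ e'' ∈ Δ, ‖e₀.1 - e''.1‖)
        (fun _ _ => Finset.sum_nonneg fun _ _ => norm_nonneg _) he)
  have hpair := pairClustering_of_perturbedClustering hcl (Real.log_nonneg one_le_two) (by norm_num) hμ' hF hδ
  have hA : (0 : ℝ) ≤ 32 * (Δ.card : ℝ) ^ 2 * Real.exp (Real.log 2 * δ) * max 1 ((K : ℝ) ^ 2) := by
    have : (0 : ℝ) ≤ max 1 ((K : ℝ) ^ 2) := le_max_of_le_left zero_le_one
    positivity
  refine ⟨μ, inferInstance, hG, hinv, summable_abs_cov_of_pairClustering (d := 4) (by norm_num) hFm hFb (Real.log_pos one_lt_two) hA hpair,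
    fun hZ => ?_⟩
  exact tendstoInDistribution_boxSum (d := 4) (by norm_num) hinv hFm hFb (Real.log_pos one_lt_two) hA hpair hZ

/-- ★★★ **EVERY `N ≥ 2` — THE CLT FOR `SU(N)` LATTICE YANG–MILLS ON `ℤ⁴` AT 't HOOFT COUPLING `0 < β < 1/64`** (tree coupling
`N β`; hypothesis-free Bakry–Émery door, rb-p1's `suN_wilson_clustering_rate`: rate `log(1/(64β))`, constant `8N n²`; translation
invariance by `oneState_translationInvariant_of_massGapAt`): one translation-invariant DLR state, and for EVERY Lipschitz cylinder `F`
the autocovariance is absolutely summable and the cube sums satisfy the central limit theorem with variance `Σ_v cov_μ(F, F∘θ_v)`.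
[folklore] -/
theorem suN_wilson_boxSum_clt {N : ℕ} (hN : 2 ≤ N) {β : ℝ} (h0 : 0 < β) (h : β < 1 / 64)
    {Ω' : Type*} [MeasurableSpace Ω'] {P' : Measure Ω'} [IsProbabilityMeasure P'] (Z : Ω' → ℝ)
    {F : LGConfig 4 (SUN N) → ℝ} {Δ : Finset (ZdEdge 4)} {K : ℝ≥0} (hF : IsLipschitzCylinder (fundamentalRep (Fin N)) F Δ K) :
    ∃ μ : Measure (LGConfig 4 (SUN N)), ∃ _ : IsProbabilityMeasure μ,
      ymGibbsMeasures (d := 4) (fundamentalRep (Fin N)) ((N : ℝ) * β) = {μ} ∧ IsZdTranslationInvariant μ ∧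
      Summable (fun v : Site 4 => |cov[F, fun U => F (configShift v U); μ]|) ∧
      (HasLaw Z (gaussianReal 0 (∑' v, cov[F, fun U => F (configShift v U); μ]).toNNReal) P' →
        TendstoInDistribution
          (fun n U => (∑ x ∈ siteBox 4 n, F (configShift x U) - (siteBox 4 n).card * ∫ V, F V ∂μ) / Real.sqrt ((siteBox 4 n).card))
          atTop Z (fun _ => μ) P') := by
  classical
  have hq : 1 < 1 / (64 * β) := by rw [lt_div_iff₀ (by positivity)]; linarith
  have ht : 0 < Real.log (1 / (64 * β)) := Real.log_pos hq
  have hZd : UniformMassGapOnBallZd 4 N β 0 0 0 (Real.log (1 / (64 * β))) (8 * N) :=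
    (suN_uniformBallZdS_rate hN h0 h).uniformMassGapOnBallZd ht.le (by norm_num) (by simp)
  obtain ⟨μ, hG, hinv⟩ := oneState_translationInvariant_of_massGapAt (hZd.massGapAt le_rfl le_rfl)
  have hμ : μ ∈ ymGibbsMeasures (d := 4) (fundamentalRep (Fin N)) ((N : ℝ) * β) := by rw [hG]; exact Set.mem_singleton μ
  have hμG : IsGibbsMeasure (ymSpecification (d := 4) (fundamentalRep (Fin N)) ((N : ℝ) * β)) μ := hμ
  haveI := hμG.isProbabilityMeasure
  have hcl := suN_wilson_clustering_rate hN h0 h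
  have hμ' : μ ∈ perturbedGibbsMeasures (d := 4) (fundamentalRep (Fin N)) ((N : ℝ) * β) 0
      (fun _ => (∅ : Finset (Finset (ZdEdge 4)))) := by
    rw [perturbedGibbsMeasures_zero]; exact hμ
  have hFm : Measurable F := hF.measurable
  have hFb : ∀ U, |F U| ≤ |F 1| + 2 * K := hF.abs_le
  set δ : ℝ := ∑ e ∈ Δ, ∑ e' ∈ Δ, ‖e.1 - e'.1‖ with hδdef
  have hδ : ∀ e ∈ Δ, ∀ e' ∈ Δ, ‖e.1 - e'.1‖ ≤ δ := fun e he e' he' =>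
    (Finset.single_le_sum (f := fun e'' : ZdEdge 4 => ‖e.1 - e''.1‖) (fun _ _ => norm_nonneg _) he').trans
      (Finset.single_le_sum (f := fun e₀ : ZdEdge 4 => ∑ e'' ∈ Δ, ‖e₀.1 - e''.1‖)
        (fun _ _ => Finset.sum_nonneg fun _ _ => norm_nonneg _) he)
  have hA0 : (0 : ℝ) ≤ 8 * N := by positivity
  have hpair := pairClustering_of_perturbedClustering hcl ht.le hA0 hμ' hF hδ
  have hA : (0 : ℝ) ≤ 8 * N * (Δ.card : ℝ) ^ 2 * Real.exp (Real.log (1 / (64 * β)) * δ) * max 1 ((K : ℝ) ^ 2) := by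
    have : (0 : ℝ) ≤ max 1 ((K : ℝ) ^ 2) := le_max_of_le_left zero_le_one
    positivity
  exact ⟨μ, inferInstance, hG, hinv, summable_abs_cov_of_pairClustering (d := 4) (by norm_num) hFm hFb ht hA hpair,
    fun hZ => tendstoInDistribution_boxSum (d := 4) (by norm_num) hinv hFm hFb ht hA hpair hZ⟩

/-- ★★ **THE PLAQUETTE (ENERGY-DENSITY) CLT**: for `|β_W| ≤ 1/12`, the plaquette field `W_p = Re tr U_p` (tree `zdPlaquetteObs`, any plane
`i < j`) of the unique DLR state of `SU(2)` lattice Yang–Mills on `ℤ⁴` has absolutely summable autocovariance and its cube sums satisfy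
`(Σ_{x∈B_n} W_{p+x} − #B_n·μ(W_p)) / √#B_n → N(0, Σ_v cov_μ(W_p, W_{p+v}))` in distribution. [folklore] -/
theorem su2_wilson_plaquette_clt {βW : ℝ} (hβ : |βW| ≤ 1 / 12)
    {Ω' : Type*} [MeasurableSpace Ω'] {P' : Measure Ω'} [IsProbabilityMeasure P'] (Z : Ω' → ℝ)
    (x : Site 4) {i j : Fin 4} (hij : i < j) :
    ∃ μ : Measure (LGConfig 4 (SUN 2)), ∃ _ : IsProbabilityMeasure μ,
      ymGibbsMeasures (d := 4) (fundamentalRep (Fin 2)) (βW / 2) = {μ} ∧ IsZdTranslationInvariant μ ∧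
      Summable (fun v : Site 4 => |cov[zdPlaquetteObs (d := 4) (fundamentalRep (Fin 2)) x i j,
        fun U => zdPlaquetteObs (d := 4) (fundamentalRep (Fin 2)) x i j (configShift v U); μ]|) ∧
      (HasLaw Z (gaussianReal 0 (∑' v, cov[zdPlaquetteObs (d := 4) (fundamentalRep (Fin 2)) x i j,
          fun U => zdPlaquetteObs (d := 4) (fundamentalRep (Fin 2)) x i j (configShift v U); μ]).toNNReal) P' →
        TendstoInDistribution
          (fun n U => (∑ y ∈ siteBox 4 n, zdPlaquetteObs (d := 4) (fundamentalRep (Fin 2)) x i j (configShift y U) -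
            (siteBox 4 n).card * ∫ V, zdPlaquetteObs (d := 4) (fundamentalRep (Fin 2)) x i j V ∂μ) / Real.sqrt ((siteBox 4 n).card))
          atTop Z (fun _ => μ) P') :=
  su2_wilson_boxSum_clt hβ Z (isLipschitzCylinder_zdPlaquetteObs (N := 2) x hij)

/-- ★★ **THE WILSON-LOOP CLT**: for `|β_W| ≤ 1/12`, every coefficient `c` and every closed lattice walk `γ` in `ℤ⁴`, the loop observable
`c·Re tr U_γ/2` (tree `loopTerm 2 c γ`) of the unique DLR state has absolutely summable autocovariance and Gaussian `√volume` fluctuations of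
its cube sums, with variance its static susceptibility. [folklore] -/
theorem su2_wilson_loop_clt {βW : ℝ} (hβ : |βW| ≤ 1 / 12)
    {Ω' : Type*} [MeasurableSpace Ω'] {P' : Measure Ω'} [IsProbabilityMeasure P'] (Z : Ω' → ℝ)
    (c : ℝ) {x : Site 4} (γ : (zdGraph 4).Walk x x) :
    ∃ μ : Measure (LGConfig 4 (SUN 2)), ∃ _ : IsProbabilityMeasure μ,
      ymGibbsMeasures (d := 4) (fundamentalRep (Fin 2)) (βW / 2) = {μ} ∧ IsZdTranslationInvariant μ ∧
      Summable (fun v : Site 4 => |cov[loopTerm (d := 4) 2 c γ, fun U => loopTerm (d := 4) 2 c γ (configShift v U); μ]|) ∧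
      (HasLaw Z (gaussianReal 0 (∑' v, cov[loopTerm (d := 4) 2 c γ, fun U => loopTerm (d := 4) 2 c γ (configShift v U); μ]).toNNReal) P' →
        TendstoInDistribution
          (fun n U => (∑ y ∈ siteBox 4 n, loopTerm (d := 4) 2 c γ (configShift y U) -
            (siteBox 4 n).card * ∫ V, loopTerm (d := 4) 2 c γ V ∂μ) / Real.sqrt ((siteBox 4 n).card))
          atTop Z (fun _ => μ) P') :=
  su2_wilson_boxSum_clt hβ Z (isLipschitzCylinder_loopTerm (N := 2) c γ)

/-- ★★★ **THE ENERGY CLT WITH THE SPECIFIC HEAT AS VARIANCE** (`SU(2)`, `ℤ⁴`, tree coupling `0 < β ≤ 1/24`, i.e. `0 < β_W ≤ 1/12`):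
for the unique DLR state `ν` and the plaquette energy density at the origin `e = Σ_{i<j} W_{(0;i,j)}` (`W_p` = tree `zdPlaquetteObs`),
`(Σ_{x∈B_n} e∘θ_x − #B_n·ν(e)) / √#B_n ⟶ N(0, ¼ f''(β))` IN DISTRIBUTION, `f` = the free energy density `freeEnergyDensity 4 ρ` —
the Gaussian energy fluctuations have the SPECIFIC HEAT as variance (`SpecificHeat.su2_tendsto_variance_energy_boxSum_div`
identifies the susceptibility of `e` with `¼ f''(β)`; the CLT is `su2_wilson_boxSum_clt`). [folklore] -/
theorem su2_wilson_energy_clt {b : ℝ} (hb0 : 0 < b) (hb : b ≤ 1 / 24)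
    {Ω' : Type*} [MeasurableSpace Ω'] {P' : Measure Ω'} [IsProbabilityMeasure P'] (Z : Ω' → ℝ) :
    ∃ ν : Measure (LGConfig 4 (SUN 2)), ∃ _ : IsProbabilityMeasure ν,
      ymGibbsMeasures (d := 4) (fundamentalRep (Fin 2)) b = {ν} ∧ IsZdTranslationInvariant ν ∧
      (HasLaw Z (gaussianReal 0 ((1 / 4 : ℝ) * deriv (deriv (freeEnergyDensity 4 (fundamentalRep (Fin 2)))) b).toNNReal) P' →
        TendstoInDistribution
          (fun n U => (∑ x ∈ siteBox 4 n, (∑ q : {q : Fin 4 × Fin 4 // q.1 < q.2},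
              zdPlaquetteObs (fundamentalRep (Fin 2)) 0 q.1.1 q.1.2 (configShift x U)) -
            (siteBox 4 n).card * ∫ V, (∑ q : {q : Fin 4 × Fin 4 // q.1 < q.2}, zdPlaquetteObs (fundamentalRep (Fin 2)) 0 q.1.1 q.1.2 V) ∂ν) /
            Real.sqrt ((siteBox 4 n).card))
          atTop Z (fun _ => ν) P') := by
  classical
  set e : LGConfig 4 (SUN 2) → ℝ :=
    fun U => ∑ q : {q : Fin 4 × Fin 4 // q.1 < q.2}, zdPlaquetteObs (fundamentalRep (Fin 2)) 0 q.1.1 q.1.2 U with he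
  have hecyl : IsLipschitzCylinder (fundamentalRep (Fin 2)) e
      ((Finset.univ : Finset {q : Fin 4 × Fin 4 // q.1 < q.2}).biUnion fun q => plaquetteEdges ((0, ⟨q.1, q.2⟩) : ZdPlaquette 4))
      (∑ q : {q : Fin 4 × Fin 4 // q.1 < q.2}, (4 * (2 : ℝ≥0) ^ 3)) :=
    isLipschitzCylinder_sum _ fun q _ => isLipschitzCylinder_zdPlaquetteObs (N := 2) 0 q.2
  have hβ : |2 * b| ≤ 1 / 12 := by rw [abs_of_pos (by linarith)]; linarith
  obtain ⟨μ, hμP, hG, hinv, hsum, hclt⟩ := su2_wilson_boxSum_clt (P' := P') hβ Z hecyl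
  rw [show (2 : ℝ) * b / 2 = b by ring] at hG
  -- the susceptibility of `e` is `¼ f''(b)` (T7) — the limit of the variance densities is unique
  obtain ⟨ν, hGν, hlimν⟩ := SpecificHeat.su2_tendsto_variance_energy_boxSum_div (b := b) ⟨hb0, by linarith⟩
  have hνμ : ν = μ := by
    have h := hGν.symm.trans hG
    exact Set.singleton_eq_singleton_iff.1 h
  subst hνμ
  have hem : Measurable e := hecyl.measurable
  have heb := hecyl.abs_le
  have hlim := ThermodynamicVariance.tendsto_variance_boxSum_div hinv hem heb hsum
  have hval : ∑' v : Site 4, cov[e, fun U => e (configShift v U); ν] =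
      (1 / 4 : ℝ) * deriv (deriv (freeEnergyDensity 4 (fundamentalRep (Fin 2)))) b := tendsto_nhds_unique hlim hlimν
  refine ⟨ν, hμP, hG, hinv, fun hZ => ?_⟩
  rw [← hval] at hZ
  exact hclt hZ

end BoxSumCLT

end Summit.Ventures.YMGap.RobustBall

end
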